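import Literature.Probability.RandomPlanarGeometry.LoewnerFarField
import Literature.Probability.RandomPlanarGeometry.LoewnerCotArgExit
import Literature.Probability.RandomPlanarGeometry.SLEKappaRhoSchrammObservable
import Mathlib.Analysis.SpecialFunctions.BinaryEntropy
import HarnessLib

/-!
# Far-field expansion of the room–entropy combination `log ψ_t + 3 H(S_t)` of a chordal Loewner chain

Topic `Literature/Probability/RandomPlanarGeometry`; companion of `LoewnerFarField.lean` (the
far-field regime `Loewner.FarRegime W z t K`: continuous driving function `W`, `|W| ≤ K` on
`[0, t]`, `64 (K + √t) ≤ ‖z‖`; expansions of `g_t(z)` and `g_t'(z)` with remainders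
`O(α³)`, `α = (K + √t)/‖z‖ ≤ 1/64`), of `LoewnerCotArgExit.lean` (the centred flow
`z_t = g_t(z) - W_t = Loewner.centredMap`, Rohde–Schramm's ratio
`ψ_t = (Im z) |g_t'(z)| / Im g_t(z) = Loewner.derivRatio`, `ψ_t = exp ∫₀ᵗ 4y²/|z|⁴`) and of
`SLEKappaRhoSchrammObservable.lean` (Schramm's observable `S_t = (1 + Re z_t/|z_t|)/2 =
Loewner.schrammObs`). It provides the DETERMINISTIC half of the identification of a driving
process by the martingale-observable method (Lawler–Schramm–Werner 2004, §3; Chelkak–Duminil-Copin–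
Hongler–Kemppainen–Smirnov 2014, §3: expand the observable at a far point, "the `O`-bounds are
uniform with respect to both `t` and `z`") for the **room–entropy combination**

  `N_t(z) = log ψ_t(z) + 3 H(S_t(z))`,  `H` = binary entropy in nats (`Real.binEntropy`),

the continuum one-point functional of the "room" (log conformal radius) of an interior point
weighted by the entropy profile `Λ(θ) = 3 H(sin²(θ/2))` of its conformal angle; `N` is a local
martingale of the chordal Loewner chain exactly when the driving function is `√(8/3) B`
(Itô: the drift of `N` is `[4 sin²θ - (2 - κ/2) sin 2θ Λ' + (κ/2) sin²θ Λ''] dt/|z_t|²`, and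
`sin θ Λ'' - cos θ Λ' + 3 sin θ = 0`).

Main results (all PROVED, every continuous driving function, absolute constants):

* `FarRegime.log_derivRatio_nonneg`, `FarRegime.log_derivRatio_le` — `0 ≤ log ψ_t ≤ 20 α²` at a
  far point with `Im z ≥ ‖z‖/2` (the room loss is second order);
* `FarRegime.abs_log_derivRatio_sub_le` — at `z = iy`: `log ψ_t = 4t/y² + O(13 α³)`;
* `FarRegime.abs_cos_centredMap_I_add_le` — at `z = iy`: `Re z_t/|z_t| = -W_t/y + O(5 α²)`;
* `FarRegime.abs_roomObs_I_sub_le` — **second order at `iy`**: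
  `N_t(iy) = 3 log 2 + (4t - (3/2) W_t²)/y² + O(140 α³)`; the bracket is
  `-(3/2) (W_t² - (8/3) t)`, which is how `κ = 8/3` is singled out;
* `FarRegime.abs_cos_centredMap_offAxis_sub_le`, `FarRegime.abs_roomObs_offAxis_sub_le` — **first
  order at `w = y (3+4i)/5`** (`cos θ₀ = 3/5`, where `1 ± cos θ₀ = 8/5, 2/5` are rational and
  `Λ'(θ₀) sin θ₀ = (24/25) log 4 ≠ 0`): `N_t(w) = 3 H(4/5) + (24 log 4/25) W_t/y + O(130 α²)`;
* `FarRegime.le_roomStop` — in the far field the ROOM STOP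
  `τ^{z,m} = inf ({u | Im z_u ≤ Im z/(m+1)} ∪ {m+1})` has not occurred by time `t ≤ m + 1`;
* `continuous_roomObs_min` — `t ↦ N_{t ∧ τ^{z,m}}(z)` is continuous for every continuous `W`
  and `z ∈ ℍ` (the room stop is strictly before the swallowing time);
* `exists_level_roomObs_order_one`, `exists_level_roomObs_order_two` — the two statements
  consumed by the probabilistic half (`Process/LocalMartingaleFromObservables.lean`): for every
  driver bound `K`, horizon `T` and `ε > 0` there are a level `y` and a cap `m` such that for
  EVERY continuous `W` and every `r ≤ T` with `|W| ≤ K` on `[0, r]`,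
  `|N^{w,m}_r - (a W_r + b)| ≤ ε |a|` (`w = y(3+4i)/5`, `a = (24 log 4/25)/y`), resp.
  `|N^{iy,m}_r - (a (W_r² - (8/3) r) + b)| ≤ ε |a|` (`a = -(3/2)/y²`).

The elementary inputs are proved here from Mathlib's logarithm bounds
(`Real.abs_log_sub_add_sum_range_le`, `Real.log_le_sub_one_of_pos`,
`Real.one_sub_inv_le_log_of_pos`): `|log x - (x-1)| ≤ 2(x-1)²`, `0 ≤ (1+u)log(1+u) - u ≤ u²`,
`|(1+u)log(1+u) - u - u²/2| ≤ 4|u|³`, the identity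
`3 H((1+c)/2) = 3 log 2 - (3/2)((1+c)log(1+c) + (1-c)log(1-c))`, the second-order behaviour
of the symmetric combination at `c = 0` and its first-order behaviour at `c = 3/5`, the
`2/|Z'|`-Lipschitz bound for the direction `Z ↦ Re Z/|Z|`, and the cosine of the direction of
`3/5 - ω + (4/5) i` to first order.

## Design choices

* No new definitions: the combination `N` and the room stop are written out in terms of the
  tree's `Loewner.derivRatio`, `Loewner.schrammObs`, `Loewner.centredMap` (the summit-side line
  `room-entropy-wright-fisher` of `SAWScalingLimit/SubseqIdentification` names them
  `roomObs`, `roomStop`, `roomObsStopped`, definitionally equal to the expressions used here).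
* The two observation points `iy` and `y(3+4i)/5` are chosen so that all constants are
  rational up to `log 2`, `log 4`; only first-order information is needed off the axis and only
  the symmetric second-order information on the axis, so no Taylor expansion of a
  transcendental function beyond the logarithmic series enters.
* Constants (`13, 5, 140, 20, 21, 130`) are generous absolute constants.

## References

* G. F. Lawler, O. Schramm, W. Werner, *Conformal invariance of planar loop-erased random walks
  and uniform spanning trees*, Ann. Probab. 32 (2004), §3 (the martingale-observable method);
  *On the scaling limit of planar self-avoiding walk*, Proc. Sympos. Pure Math. 72 (2004), §2.
* D. Chelkak, H. Duminil-Copin, C. Hongler, A. Kemppainen, S. Smirnov, *Convergence of Ising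
  interfaces to Schramm's SLE curves*, C. R. Math. Acad. Sci. Paris 352 (2014) 157–161, §3.
* S. Rohde, O. Schramm, *Basic properties of SLE*, Ann. of Math. 161 (2005), Lemma 6.3 and
  eq. (6.3) (`ψ_t`, `z_t`).
* O. Schramm, *A percolation formula*, Electron. Comm. Probab. 6 (2001), Thm. 2 (`S_t`).
* G. F. Lawler, *Conformally Invariant Processes in the Plane*, AMS (2005), Lemma 4.13.
-/
noncomputable section

open Set Filter Topology Metric MeasureTheory Complex
open scoped NNReal

namespace Literature.Probability.RandomPlanarGeometry

namespace Loewner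

/-! ### Elementary real inequalities: logarithms and the entropy combination -/

section Elementary

/-- `|log x - (x - 1)| ≤ 2 (x - 1)²` for `|x - 1| ≤ 1/2` (one term of the logarithmic series,
Mathlib's `Real.abs_log_sub_add_sum_range_le`). [folklore] -/
theorem abs_log_sub_sub_one_le {x : ℝ} (hx : |x - 1| ≤ 1 / 2) :
    |Real.log x - (x - 1)| ≤ 2 * (x - 1) ^ 2 := by
  have hv1 : |(-(x - 1))| < 1 := by rw [abs_neg]; linarith
  have h := Real.abs_log_sub_add_sum_range_le hv1 1
  simp only [Finset.sum_range_one, Nat.cast_zero, zero_add, pow_one, div_one, sub_neg_eq_add,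
    abs_neg] at h
  have h2 : |x - 1| ^ 2 / (1 - |x - 1|) ≤ 2 * (x - 1) ^ 2 := by
    rw [div_le_iff₀ (by linarith), sq_abs]
    nlinarith [sq_nonneg (x - 1), abs_nonneg (x - 1)]
  calc |Real.log x - (x - 1)| = |-(x - 1) + Real.log (1 + (x - 1))| := by ring_nf
    _ ≤ |x - 1| ^ (1 + 1) / (1 - |x - 1|) := h
    _ = |x - 1| ^ 2 / (1 - |x - 1|) := by norm_num
    _ ≤ 2 * (x - 1) ^ 2 := h2

/-- `0 ≤ (1+u) log(1+u) - u` for `u > -1` (`1 - x⁻¹ ≤ log x`). [folklore] -/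
theorem mul_log_one_add_sub_nonneg {u : ℝ} (hu : -1 < u) :
    0 ≤ (1 + u) * Real.log (1 + u) - u := by
  have hx : 0 < 1 + u := by linarith
  have h := Real.one_sub_inv_le_log_of_pos hx
  have h2 : (1 + u) * (1 - (1 + u)⁻¹) = u := by field_simp; ring
  nlinarith [mul_le_mul_of_nonneg_left h hx.le]

/-- `(1+u) log(1+u) - u ≤ u²` for `u > -1` (`log x ≤ x - 1`). [folklore] -/
theorem mul_log_one_add_sub_le {u : ℝ} (hu : -1 < u) :
    (1 + u) * Real.log (1 + u) - u ≤ u ^ 2 := by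
  have hx : 0 < 1 + u := by linarith
  have h := Real.log_le_sub_one_of_pos hx
  nlinarith [mul_le_mul_of_nonneg_left h hx.le]

/-- `|(1+u) log(1+u) - u - u²/2| ≤ 4|u|³` for `|u| ≤ 1/2` (two terms of the logarithmic
series). [folklore] -/
theorem abs_mul_log_one_add_sub_le {u : ℝ} (hu : |u| ≤ 1 / 2) :
    |(1 + u) * Real.log (1 + u) - u - u ^ 2 / 2| ≤ 4 * |u| ^ 3 := by
  have hu1 : |(-u)| < 1 := by rw [abs_neg]; linarith
  have h := Real.abs_log_sub_add_sum_range_le hu1 2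
  simp only [Finset.sum_range_succ, Finset.sum_range_zero, Nat.cast_zero, zero_add, pow_one,
    div_one, Nat.cast_one, sub_neg_eq_add, abs_neg] at h
  -- `h : |-u + (-u)^2/(1+1) + log (1+u)| ≤ |u|^3/(1-|u|)`
  set r := Real.log (1 + u) - u + u ^ 2 / 2 with hr
  have hr2 : |r| ≤ 2 * |u| ^ 3 := by
    have h1 : |r| ≤ |u| ^ (2 + 1) / (1 - |u|) := by
      refine le_trans (le_of_eq ?_) h
      rw [hr]; congr 1; ring
    have h2 : |u| ^ (2 + 1) / (1 - |u|) ≤ 2 * |u| ^ 3 := by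
      rw [show (2 + 1 : ℕ) = 3 by norm_num, div_le_iff₀ (by linarith)]
      have h0 : 0 ≤ |u| ^ 3 := by positivity
      nlinarith
    exact h1.trans h2
  have hid : (1 + u) * Real.log (1 + u) - u - u ^ 2 / 2 = (1 + u) * r - u ^ 3 / 2 := by
    rw [hr]; ring
  rw [hid]
  have hab : |u| ^ 3 = |u ^ 3| := by rw [abs_pow]
  calc |(1 + u) * r - u ^ 3 / 2| ≤ |(1 + u) * r| + |u ^ 3 / 2| := abs_sub _ _
    _ = |1 + u| * |r| + |u| ^ 3 / 2 := by
        rw [abs_mul, abs_div, hab, abs_of_pos (by norm_num : (0 : ℝ) < 2)]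
    _ ≤ (3 / 2) * (2 * |u| ^ 3) + |u| ^ 3 / 2 := by
        gcongr
        calc |1 + u| ≤ |1| + |u| := abs_add_le _ _
          _ ≤ 1 + 1 / 2 := by rw [abs_one]; gcongr
          _ = 3 / 2 := by norm_num
    _ ≤ 4 * |u| ^ 3 := by nlinarith [pow_nonneg (abs_nonneg u) 3]

/-- **The entropy combination in Schramm's coordinate.** For `|c| < 1`,
`3 H((1+c)/2) = 3 log 2 - (3/2) ((1+c) log(1+c) + (1-c) log(1-c))` (`H` = binary entropy in
nats, Mathlib `Real.binEntropy`). [folklore] -/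
theorem three_mul_binEntropy_half_add (c : ℝ) (hc : |c| < 1) :
    3 * Real.binEntropy ((1 + c) / 2) =
      3 * Real.log 2 - 3 / 2 * ((1 + c) * Real.log (1 + c) + (1 - c) * Real.log (1 - c)) := by
  have hc' := abs_lt.1 hc
  have h1 : (1 + c) ≠ 0 := by linarith
  have h2 : (1 - c) ≠ 0 := by linarith
  rw [Real.binEntropy_eq_negMulLog_add_negMulLog_one_sub]
  simp only [Real.negMulLog]
  have e1 : Real.log ((1 + c) / 2) = Real.log (1 + c) - Real.log 2 := Real.log_div h1 two_ne_zero
  have e2 : (1 : ℝ) - (1 + c) / 2 = (1 - c) / 2 := by ring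
  have e3 : Real.log ((1 - c) / 2) = Real.log (1 - c) - Real.log 2 := Real.log_div h2 two_ne_zero
  rw [e2, e1, e3]
  ring

/-- Second-order behaviour at `c = 0`: `|(1+h)log(1+h) + (1-h)log(1-h) - h²| ≤ 8|h|³` for
`|h| ≤ 1/2`. [folklore] -/
theorem abs_symmMulLog_sub_sq_le {h : ℝ} (hh : |h| ≤ 1 / 2) :
    |(1 + h) * Real.log (1 + h) + (1 - h) * Real.log (1 - h) - h ^ 2| ≤ 8 * |h| ^ 3 := by
  have h1 := abs_mul_log_one_add_sub_le hh
  have h2 := abs_mul_log_one_add_sub_le (u := -h) (by rwa [abs_neg])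
  rw [abs_neg] at h2
  have hid : (1 + h) * Real.log (1 + h) + (1 - h) * Real.log (1 - h) - h ^ 2 =
      ((1 + h) * Real.log (1 + h) - h - h ^ 2 / 2) +
        ((1 + -h) * Real.log (1 + -h) - -h - (-h) ^ 2 / 2) := by ring
  rw [hid]
  exact (abs_add_le _ _).trans (by linarith)

/-- First-order behaviour at `c = 3/5` (where `1 ± c = 8/5, 2/5` and the derivative is
`log(8/5) - log(2/5) = log 4`): for `|h| ≤ 1/5`,
`0 ≤ f(3/5 + h) - f(3/5) - h log 4 ≤ (25/8) h²`, `f(c) = (1+c)log(1+c) + (1-c)log(1-c)`.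
[folklore] -/
theorem symmMulLog_three_fifths_expansion {h : ℝ} (hh : |h| ≤ 1 / 5) :
    0 ≤ ((1 + (3 / 5 + h)) * Real.log (1 + (3 / 5 + h)) + (1 - (3 / 5 + h)) * Real.log (1 - (3 / 5 + h))) -
        ((8 / 5 : ℝ) * Real.log (8 / 5) + (2 / 5 : ℝ) * Real.log (2 / 5)) - h * Real.log 4 ∧
    ((1 + (3 / 5 + h)) * Real.log (1 + (3 / 5 + h)) + (1 - (3 / 5 + h)) * Real.log (1 - (3 / 5 + h))) -
        ((8 / 5 : ℝ) * Real.log (8 / 5) + (2 / 5 : ℝ) * Real.log (2 / 5)) - h * Real.log 4 ≤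
      25 / 8 * h ^ 2 := by
  have hh' := abs_le.1 hh
  set u₁ : ℝ := 5 * h / 8 with hu₁
  set u₂ : ℝ := 5 * h / 2 with hu₂
  have hu₁' : -1 < u₁ := by rw [hu₁]; linarith
  have hu₂' : -1 < -u₂ := by rw [hu₂]; linarith
  have e1 : (1 : ℝ) + (3 / 5 + h) = 8 / 5 * (1 + u₁) := by rw [hu₁]; ring
  have e2 : (1 : ℝ) - (3 / 5 + h) = 2 / 5 * (1 + -u₂) := by rw [hu₂]; ring
  have l1 : Real.log (8 / 5 * (1 + u₁)) = Real.log (8 / 5) + Real.log (1 + u₁) :=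
    Real.log_mul (by norm_num) (by linarith)
  have l2 : Real.log (2 / 5 * (1 + -u₂)) = Real.log (2 / 5) + Real.log (1 + -u₂) :=
    Real.log_mul (by norm_num) (by linarith)
  have l4 : Real.log 4 = Real.log (8 / 5) - Real.log (2 / 5) := by
    rw [← Real.log_div (by norm_num) (by norm_num)]; norm_num
  have key : ((1 + (3 / 5 + h)) * Real.log (1 + (3 / 5 + h)) +
        (1 - (3 / 5 + h)) * Real.log (1 - (3 / 5 + h))) -
      ((8 / 5 : ℝ) * Real.log (8 / 5) + (2 / 5 : ℝ) * Real.log (2 / 5)) - h * Real.log 4 =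
      8 / 5 * ((1 + u₁) * Real.log (1 + u₁) - u₁) + 2 / 5 * ((1 + -u₂) * Real.log (1 + -u₂) - -u₂) := by
    rw [e1, e2, l1, l2, l4, hu₁, hu₂]; ring
  rw [key]
  have a1 := mul_log_one_add_sub_nonneg hu₁'
  have a2 := mul_log_one_add_sub_le hu₁'
  have b1 := mul_log_one_add_sub_nonneg hu₂'
  have b2 := mul_log_one_add_sub_le hu₂'
  constructor
  · positivity
  · have : 8 / 5 * u₁ ^ 2 + 2 / 5 * (-u₂) ^ 2 = 25 / 8 * h ^ 2 := by rw [hu₁, hu₂]; ring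
    nlinarith

/-- **The direction `Z/|Z|` is Lipschitz away from `0`**: `|Re Z/‖Z‖ - Re Z'/‖Z'‖| ≤ 2‖Z - Z'‖/‖Z'‖`
for `Z' ≠ 0`. [folklore] -/
theorem abs_re_div_norm_sub_le (Z : ℂ) {Z' : ℂ} (hZ' : Z' ≠ 0) :
    |Z.re / ‖Z‖ - Z'.re / ‖Z'‖| ≤ 2 * ‖Z - Z'‖ / ‖Z'‖ := by
  have hn' : 0 < ‖Z'‖ := norm_pos_iff.2 hZ'
  have hid : Z.re / ‖Z‖ - Z'.re / ‖Z'‖ = (Z.re - Z'.re) / ‖Z'‖ + Z.re * (1 / ‖Z‖ - 1 / ‖Z'‖) := by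
    ring
  rw [hid]
  have h1 : |(Z.re - Z'.re) / ‖Z'‖| ≤ ‖Z - Z'‖ / ‖Z'‖ := by
    rw [abs_div, abs_of_pos hn']
    gcongr
    simpa using abs_re_le_norm (Z - Z')
  have h2 : |Z.re * (1 / ‖Z‖ - 1 / ‖Z'‖)| ≤ ‖Z - Z'‖ / ‖Z'‖ := by
    rcases eq_or_ne Z 0 with rfl | hZ
    · simp only [zero_re, zero_mul, abs_zero]; positivity
    · have hn : 0 < ‖Z‖ := norm_pos_iff.2 hZ
      rw [abs_mul]
      calc |Z.re| * |1 / ‖Z‖ - 1 / ‖Z'‖| ≤ ‖Z‖ * |1 / ‖Z‖ - 1 / ‖Z'‖| := by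
            gcongr; exact abs_re_le_norm Z
        _ = |‖Z‖ * (1 / ‖Z‖ - 1 / ‖Z'‖)| := by rw [abs_mul, abs_of_pos hn]
        _ = |(‖Z'‖ - ‖Z‖) / ‖Z'‖| := by congr 1; field_simp
        _ = |‖Z'‖ - ‖Z‖| / ‖Z'‖ := by rw [abs_div, abs_of_pos hn']
        _ ≤ ‖Z - Z'‖ / ‖Z'‖ := by
            gcongr
            rw [abs_sub_comm]; exact abs_norm_sub_norm_le Z Z'
  calc |(Z.re - Z'.re) / ‖Z'‖ + Z.re * (1 / ‖Z‖ - 1 / ‖Z'‖)|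
      ≤ |(Z.re - Z'.re) / ‖Z'‖| + |Z.re * (1 / ‖Z‖ - 1 / ‖Z'‖)| := abs_add_le _ _
    _ ≤ ‖Z - Z'‖ / ‖Z'‖ + ‖Z - Z'‖ / ‖Z'‖ := add_le_add h1 h2
    _ = 2 * ‖Z - Z'‖ / ‖Z'‖ := by ring

/-- The cosine of the direction of `3/5 - ω + (4/5) i` to first order in `ω`:
`|(3/5 - ω)/√((3/5 - ω)² + (4/5)²) - (3/5 - (16/25) ω)| ≤ ω²` for `|ω| ≤ 1/64`. [folklore] -/
theorem abs_cos_dir_sub_le {ω : ℝ} (hω : |ω| ≤ 1 / 64) :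
    |(3 / 5 - ω) / Real.sqrt ((3 / 5 - ω) ^ 2 + (4 / 5) ^ 2) - (3 / 5 - 16 / 25 * ω)| ≤ ω ^ 2 := by
  have hω' := abs_le.1 hω
  set s := Real.sqrt ((3 / 5 - ω) ^ 2 + (4 / 5) ^ 2) with hs
  have hs2 : s ^ 2 = (3 / 5 - ω) ^ 2 + (4 / 5) ^ 2 := by
    rw [hs, Real.sq_sqrt (by positivity)]
  have hs0 : 0 ≤ s := Real.sqrt_nonneg _
  have hs45 : 4 / 5 ≤ s := by
    rw [hs]; apply Real.le_sqrt_of_sq_le; nlinarith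
  have hspos : 0 < s := by linarith
  set p : ℝ := 1 - 3 / 5 * ω with hp
  have hp0 : 0 < p := by rw [hp]; linarith
  have hsp : s ^ 2 - p ^ 2 = 16 / 25 * ω ^ 2 := by rw [hs2, hp]; ring
  have hsp' : p ≤ s := by nlinarith
  have hsum : 17 / 10 ≤ s + p := by rw [hp]; linarith
  have hdiff : s - p ≤ 2 / 5 * ω ^ 2 := by
    have : (s - p) * (s + p) = 16 / 25 * ω ^ 2 := by nlinarith
    by_contra hcon
    rw [not_le] at hcon
    nlinarith
  rw [div_sub' hspos.ne', abs_div, abs_of_pos hspos, div_le_iff₀ hspos]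
  have hid : 3 / 5 - ω - s * (3 / 5 - 16 / 25 * ω) =
      -(48 / 125) * ω ^ 2 - (s - p) * (3 / 5 - 16 / 25 * ω) := by rw [hp]; ring
  rw [hid, abs_le]
  constructor <;> nlinarith [mul_nonneg (sub_nonneg.2 hsp') (show (0:ℝ) ≤ 3 / 5 - 16 / 25 * ω by linarith)]

end Elementary

/-! ### Far-field sizes -/

namespace FarRegime

variable {W : ℝ≥0 → ℝ} {z : ℂ} {t : ℝ≥0} {K : ℝ}

/-- The driver at the final time is bounded by `K`. [folklore] -/
theorem abs_driver_le (h : FarRegime W z t K) : |W t| ≤ K := by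
  have := h.bound t ⟨t.coe_nonneg, le_rfl⟩
  rwa [Real.toNNReal_coe] at this

/-- `|W_t| ≤ α ‖z‖`. [folklore] -/
theorem abs_driver_le_alpha (h : FarRegime W z t K) :
    |W t| ≤ (K + Real.sqrt t) / ‖z‖ * ‖z‖ :=
  h.abs_driver_le.trans h.K_le

/-- The far point barely moves: `‖g_t(z) - z‖ ≤ 8 α² ‖z‖`. [cite: Lawler2005, Lemma 4.13] -/
theorem norm_map_sub_self_le (h : FarRegime W z t K) :
    ‖map W t z - z‖ ≤ 8 * ((K + Real.sqrt t) / ‖z‖) ^ 2 * ‖z‖ := by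
  have h1 := (h.flow.2 t le_rfl).2
  have ht := h.t_le
  have hρ := h.pos
  calc ‖map W t z - z‖ ≤ 8 / ‖z‖ * t := h1
    _ ≤ 8 / ‖z‖ * (((K + Real.sqrt t) / ‖z‖) ^ 2 * ‖z‖ ^ 2) := by gcongr
    _ = 8 * ((K + Real.sqrt t) / ‖z‖) ^ 2 * ‖z‖ := by field_simp

/-- The centred flow is close to `z - W_t`: `‖z_t - (z - W_t)‖ ≤ 8 α² ‖z‖`. [folklore] -/
theorem norm_centredMap_sub_le (h : FarRegime W z t K) :
    ‖centredMap W t z - (z - W t)‖ ≤ 8 * ((K + Real.sqrt t) / ‖z‖) ^ 2 * ‖z‖ := by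
  rw [centredMap_apply, show map W t z - W t - (z - W t) = map W t z - z by ring]
  exact h.norm_map_sub_self_le

/-- The imaginary part barely decreases: `Im g_t(z) ≥ Im z - 8 α² ‖z‖`. [folklore] -/
theorem im_sub_le_im_map (h : FarRegime W z t K) :
    z.im - 8 * ((K + Real.sqrt t) / ‖z‖) ^ 2 * ‖z‖ ≤ (map W t z).im := by
  have h1 := h.norm_map_sub_self_le
  have h2 : |(map W t z - z).im| ≤ ‖map W t z - z‖ := abs_im_le_norm _
  rw [sub_im] at h2
  have := (abs_le.1 (h2.trans h1)).1
  linarith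

/-- `‖g_t'(z)‖ ≤ 1 + 3 α²`. [folklore] -/
theorem norm_deriv_map_le (h : FarRegime W z t K) :
    ‖deriv (map W t) z‖ ≤ 1 + 3 * ((K + Real.sqrt t) / ‖z‖) ^ 2 := by
  obtain ⟨g, hg⟩ := h.exists_sol
  have hd := h.norm_deriv_map_sub_le hg
  have ht := h.t_le
  have hα := h.alpha_le
  have hα0 := h.alpha_nonneg
  set α := (K + Real.sqrt t) / ‖z‖ with hαdef
  have hρ := h.pos
  have hb : ‖(1 : ℂ) - 2 * t / z ^ 2‖ ≤ 1 + 2 * α ^ 2 := by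
    calc ‖(1 : ℂ) - 2 * t / z ^ 2‖ ≤ ‖(1 : ℂ)‖ + ‖(2 : ℂ) * t / z ^ 2‖ := norm_sub_le _ _
      _ = 1 + 2 * t / ‖z‖ ^ 2 := by
          rw [norm_one, norm_div, norm_mul, norm_pow, Complex.norm_real, Real.norm_eq_abs,
            abs_of_nonneg t.coe_nonneg]
          simp
      _ ≤ 1 + 2 * α ^ 2 := by
          gcongr
          rw [div_le_iff₀ (by positivity)]
          linarith
  calc ‖deriv (map W t) z‖ = ‖(deriv (map W t) z - (1 - 2 * t / z ^ 2)) + (1 - 2 * t / z ^ 2)‖ := by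
        ring_nf
    _ ≤ ‖deriv (map W t) z - (1 - 2 * t / z ^ 2)‖ + ‖(1 : ℂ) - 2 * t / z ^ 2‖ := norm_add_le _ _
    _ ≤ 11 * α ^ 3 + (1 + 2 * α ^ 2) := add_le_add hd hb
    _ ≤ 1 + 3 * α ^ 2 := by nlinarith [pow_nonneg hα0 2]

/-- Before the swallowing time `log ψ_t ≥ 0` (`ψ_t ≥ 1`). [cite: RohdeSchramm2005, Lemma 6.3] -/
theorem log_derivRatio_nonneg (h : FarRegime W z t K) (hz : 0 < z.im) :
    0 ≤ Real.log (derivRatio W z t) :=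
  Real.log_nonneg (one_le_derivRatio h.cont hz h.flow.1)

/-- **The log-conformal-radius loss is second order at a far point**: `0 ≤ log ψ_t ≤ 20 α²` when
`Im z ≥ ‖z‖/2`. [folklore] -/
theorem log_derivRatio_le (h : FarRegime W z t K) (hz : ‖z‖ / 2 ≤ z.im) :
    Real.log (derivRatio W z t) ≤ 20 * ((K + Real.sqrt t) / ‖z‖) ^ 2 := by
  have hα := h.alpha_le
  have hα0 := h.alpha_nonneg
  have him := h.im_sub_le_im_map
  have hd := h.norm_deriv_map_le
  set α := (K + Real.sqrt t) / ‖z‖ with hαdef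
  have hρ := h.pos
  have hzim : 0 < z.im := by linarith
  have hα2 : α ^ 2 ≤ 1 / 64 ^ 2 := by
    rw [show (1 : ℝ) / 64 ^ 2 = (1 / 64) ^ 2 by norm_num]
    exact pow_le_pow_left₀ hα0 hα 2
  have hden : z.im * (1 - 16 * α ^ 2) ≤ (map W t z).im := by
    have : 8 * α ^ 2 * ‖z‖ ≤ 16 * α ^ 2 * z.im := by nlinarith [pow_nonneg hα0 2]
    linarith
  have hden0 : 0 < z.im * (1 - 16 * α ^ 2) := by
    apply mul_pos hzim; nlinarith
  have hmpos : 0 < (map W t z).im := hden0.trans_le hden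
  have hψ : derivRatio W z t ≤ (1 + 3 * α ^ 2) / (1 - 16 * α ^ 2) := by
    rw [derivRatio_apply, div_le_div_iff₀ hmpos (by nlinarith)]
    calc z.im * ‖deriv (map W t) z‖ * (1 - 16 * α ^ 2)
        = ‖deriv (map W t) z‖ * (z.im * (1 - 16 * α ^ 2)) := by ring
      _ ≤ (1 + 3 * α ^ 2) * (map W t z).im := by
          apply mul_le_mul hd hden hden0.le (by positivity)
  have hψ1 := one_le_derivRatio h.cont hzim h.flow.1
  calc Real.log (derivRatio W z t) ≤ derivRatio W z t - 1 := Real.log_le_sub_one_of_pos (by linarith)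
    _ ≤ (1 + 3 * α ^ 2) / (1 - 16 * α ^ 2) - 1 := by linarith
    _ ≤ 20 * α ^ 2 := by
        rw [div_sub_one (by nlinarith), div_le_iff₀ (by nlinarith)]
        nlinarith [pow_nonneg hα0 2]

/-! #### The point `iy` on the imaginary axis: second order -/

section ImagAxis

variable {y : ℝ}

/-- `‖iy‖ = y` for `y > 0`. [folklore] -/
theorem norm_I_mul (hy : 0 < y) : ‖(I * y : ℂ)‖ = y := by simp [abs_of_pos hy]

/-- **`log ψ_t = 4t/y² + O(α³)` at `z = iy`**:
`|log ψ_t(iy) - 4t/y²| ≤ 13 α³` (`g_t' = 1 + 2t/y² + O(α³)`, `Im g_t = y - 2t/y + O(α⁴ y)`).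
[folklore] -/
theorem abs_log_derivRatio_sub_le (h : FarRegime W (I * y) t K) (hy : 0 < y) :
    |Real.log (derivRatio W (I * y) t) - 4 * t / y ^ 2| ≤ 13 * ((K + Real.sqrt t) / y) ^ 3 := by
  obtain ⟨g, hg⟩ := h.exists_sol
  have hnorm := norm_I_mul hy
  have hK := h.K_le
  have hK0 := h.K_nonneg
  have ht := h.t_le
  have hα := h.alpha_le
  have hα0 := h.alpha_nonneg
  have hd := h.norm_deriv_map_sub_le hg
  have hE := h.norm_g_sub_expansion_le hg
  have hI := h.norm_integral_W_le
  rw [hnorm] at hK ht hα hα0 hd hE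
  set α := (K + Real.sqrt t) / y with hαdef
  have hmap : map W t (I * y) = g t := by
    have := h.map_eq hg (s := t) ⟨t.coe_nonneg, le_rfl⟩
    rwa [Real.toNNReal_coe] at this
  have hy0 : (y : ℂ) ≠ 0 := ofReal_ne_zero.2 hy.ne'
  set a : ℝ := 2 * t / y ^ 2 with hadef
  have ha0 : 0 ≤ a := by positivity
  have ha : a ≤ 2 * α ^ 2 := by
    rw [hadef, div_le_iff₀ (by positivity)]; linarith
  -- the derivative
  have hmain1 : (1 : ℂ) - 2 * t / (I * y) ^ 2 = ((1 + a : ℝ) : ℂ) := by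
    rw [hadef]; push_cast; field_simp; ring_nf; simp [I_sq]; ring
  set A := ‖deriv (map W t) (I * y)‖ with hAdef
  have hA : |A - (1 + a)| ≤ 11 * α ^ 3 := by
    have h1 : |A - ‖((1 + a : ℝ) : ℂ)‖| ≤ ‖deriv (map W t) (I * y) - ((1 + a : ℝ) : ℂ)‖ :=
      abs_norm_sub_norm_le _ _
    rw [← hmain1] at h1
    have h2 : ‖((1 + a : ℝ) : ℂ)‖ = 1 + a := by
      rw [norm_real, Real.norm_eq_abs, abs_of_nonneg (by positivity)]
    rw [hmain1, h2] at h1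
    rw [hmain1] at hd
    exact h1.trans (by rw [← hmain1]; rw [hmain1]; exact hd)
  -- the imaginary part of the map
  set J : ℝ := ∫ s in (0 : ℝ)..t, W s.toNNReal with hJdef
  have hJ : (∫ s in (0 : ℝ)..t, (W s.toNNReal : ℂ)) = (J : ℂ) := intervalIntegral.integral_ofReal
  have hmain2 : (I * y : ℂ) + 2 * t / (I * y) + 2 / (I * y) ^ 2 * (J : ℂ) =
      ((-(2 / y ^ 2) * J : ℝ) : ℂ) + ((y - 2 * t / y : ℝ) : ℂ) * I := by
    push_cast; field_simp; ring_nf; simp [I_sq, I_pow_three]; ring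
  set E₂ := g t - (I * y) - 2 * t / (I * y) - 2 / (I * y) ^ 2 * (J : ℂ) with hE₂def
  rw [hJ] at hE
  have hE₂ : ‖E₂‖ ≤ 32 * α ^ 4 * y := hE
  have hgt : g t = ((-(2 / y ^ 2) * J : ℝ) : ℂ) + ((y - 2 * t / y : ℝ) : ℂ) * I + E₂ := by
    rw [← hmain2, hE₂def]; ring
  have him : (g t).im = y - 2 * t / y + E₂.im := by
    rw [hgt, add_im, add_im, ofReal_im, mul_im, ofReal_re, ofReal_im, I_re, I_im]; ring
  set B : ℝ := (g t).im / y with hBdef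
  have hB : |B - (1 - a)| ≤ 32 * α ^ 4 := by
    have h1 : B - (1 - a) = E₂.im / y := by
      rw [hBdef, him, hadef]; field_simp; ring
    rw [h1, abs_div, abs_of_pos hy, div_le_iff₀ hy]
    exact (abs_im_le_norm _).trans hE₂
  -- sizes
  have hα2 : α ^ 2 ≤ (1 / 64) ^ 2 := pow_le_pow_left₀ hα0 hα 2
  have hα3 : α ^ 3 ≤ α ^ 2 * (1 / 64) := by
    calc α ^ 3 = α ^ 2 * α := by ring
      _ ≤ α ^ 2 * (1 / 64) := by gcongr
  have hα4 : α ^ 4 ≤ α ^ 3 * (1 / 64) := by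
    calc α ^ 4 = α ^ 3 * α := by ring
      _ ≤ α ^ 3 * (1 / 64) := by gcongr
  have hα30 : 0 ≤ α ^ 3 := pow_nonneg hα0 3
  have hα40 : 0 ≤ α ^ 4 := pow_nonneg hα0 4
  have hA' := abs_le.1 hA
  have hB' := abs_le.1 hB
  have hA1 : |A - 1| ≤ 3 * α ^ 2 := by
    rw [abs_le]; constructor <;> linarith
  have hB1 : |B - 1| ≤ 3 * α ^ 2 := by
    rw [abs_le]; constructor <;> linarith
  have h3α : 3 * α ^ 2 ≤ 1 / 2 := by linarith
  have hA1' := abs_le.1 hA1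
  have hB1' := abs_le.1 hB1
  have hApos : 0 < A := by linarith
  have hBpos : 0 < B := by linarith
  -- `ψ = A / B`
  have hψ : derivRatio W (I * y) t = A / B := by
    rw [derivRatio_apply, hmap, hBdef, ← hAdef]
    simp only [mul_im, I_re, I_im, ofReal_re, ofReal_im, zero_mul, one_mul, zero_add]
    field_simp
  rw [hψ, Real.log_div hApos.ne' hBpos.ne']
  have hlA := abs_log_sub_sub_one_le (hA1.trans h3α)
  have hlB := abs_log_sub_sub_one_le (hB1.trans h3α)
  have hsqA : (A - 1) ^ 2 ≤ 9 * α ^ 4 := by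
    have : (A - 1) ^ 2 = |A - 1| ^ 2 := (sq_abs _).symm
    rw [this]
    calc |A - 1| ^ 2 ≤ (3 * α ^ 2) ^ 2 := pow_le_pow_left₀ (abs_nonneg _) hA1 2
      _ = 9 * α ^ 4 := by ring
  have hsqB : (B - 1) ^ 2 ≤ 9 * α ^ 4 := by
    have : (B - 1) ^ 2 = |B - 1| ^ 2 := (sq_abs _).symm
    rw [this]
    calc |B - 1| ^ 2 ≤ (3 * α ^ 2) ^ 2 := pow_le_pow_left₀ (abs_nonneg _) hB1 2
      _ = 9 * α ^ 4 := by ring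
  have hid : Real.log A - Real.log B - 4 * t / y ^ 2 =
      (Real.log A - (A - 1)) - (Real.log B - (B - 1)) + ((A - (1 + a)) - (B - (1 - a))) := by
    rw [hadef]; ring
  rw [hid]
  calc |(Real.log A - (A - 1)) - (Real.log B - (B - 1)) + ((A - (1 + a)) - (B - (1 - a)))|
      ≤ |(Real.log A - (A - 1)) - (Real.log B - (B - 1))| + |(A - (1 + a)) - (B - (1 - a))| :=
        abs_add_le _ _
    _ ≤ (|Real.log A - (A - 1)| + |Real.log B - (B - 1)|) + (|A - (1 + a)| + |B - (1 - a)|) :=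
        add_le_add (abs_sub _ _) (abs_sub _ _)
    _ ≤ (2 * (A - 1) ^ 2 + 2 * (B - 1) ^ 2) + (11 * α ^ 3 + 32 * α ^ 4) := by
        gcongr
    _ ≤ 13 * α ^ 3 := by linarith

/-- **Schramm's cosine at `iy` to first order**: with `c_t = Re z_t/|z_t|` (`S_t = (1 + c_t)/2`),
`|c_t + W_t/y| ≤ 5 α²` and `|c_t| ≤ 2α` (`z_t = iy - W_t + O(α² y)`, `Re z_t = -W_t + O(α³ y)`).
[folklore] -/
theorem abs_cos_centredMap_I_add_le (h : FarRegime W (I * y) t K) (hy : 0 < y) :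
    |(centredMap W t (I * y)).re / ‖centredMap W t (I * y)‖ + W t / y| ≤
        5 * ((K + Real.sqrt t) / y) ^ 2 ∧
      |(centredMap W t (I * y)).re / ‖centredMap W t (I * y)‖| ≤ 2 * ((K + Real.sqrt t) / y) := by
  obtain ⟨g, hg⟩ := h.exists_sol
  have hnorm := norm_I_mul hy
  have hK := h.K_le
  have hK0 := h.K_nonneg
  have ht := h.t_le
  have hα := h.alpha_le
  have hα0 := h.alpha_nonneg
  have hE := h.norm_g_sub_expansion_le hg
  have hI := h.norm_integral_W_le
  have hmove := h.g_sub_z hg (s := t) ⟨t.coe_nonneg, le_rfl⟩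
  have hWt := h.abs_driver_le
  rw [hnorm] at hK ht hα hα0 hE hmove
  set α := (K + Real.sqrt t) / y with hαdef
  have hmap : map W t (I * y) = g t := by
    have := h.map_eq hg (s := t) ⟨t.coe_nonneg, le_rfl⟩
    rwa [Real.toNNReal_coe] at this
  have hy0 : (y : ℂ) ≠ 0 := ofReal_ne_zero.2 hy.ne'
  set J : ℝ := ∫ s in (0 : ℝ)..t, W s.toNNReal with hJdef
  have hJ : (∫ s in (0 : ℝ)..t, (W s.toNNReal : ℂ)) = (J : ℂ) := intervalIntegral.integral_ofReal
  have hJn : |J| ≤ K * t := by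
    have : ‖(J : ℂ)‖ = |J| := by rw [norm_real, Real.norm_eq_abs]
    rw [← this, ← hJ]; exact hI
  have hmain2 : (I * y : ℂ) + 2 * t / (I * y) + 2 / (I * y) ^ 2 * (J : ℂ) =
      ((-(2 / y ^ 2) * J : ℝ) : ℂ) + ((y - 2 * t / y : ℝ) : ℂ) * I := by
    push_cast; field_simp; ring_nf; simp [I_sq, I_pow_three]; ring
  set E₂ := g t - (I * y) - 2 * t / (I * y) - 2 / (I * y) ^ 2 * (J : ℂ) with hE₂def
  rw [hJ] at hE
  have hE₂ : ‖E₂‖ ≤ 32 * α ^ 4 * y := hE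
  have hgt : g t = ((-(2 / y ^ 2) * J : ℝ) : ℂ) + ((y - 2 * t / y : ℝ) : ℂ) * I + E₂ := by
    rw [← hmain2, hE₂def]; ring
  -- the centred point and its real part
  set Z := centredMap W t (I * y) with hZdef
  have hZ : Z = g t - W t := by rw [hZdef, centredMap_apply, hmap]
  have hre : Z.re = -(2 / y ^ 2) * J + E₂.re - W t := by
    rw [hZ, sub_re, hgt, add_re, add_re, ofReal_re, mul_re, ofReal_re, ofReal_im, I_re, I_im,
      ofReal_re]
    ring
  have hα2 : α ^ 2 ≤ (1 / 64) ^ 2 := pow_le_pow_left₀ hα0 hα 2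
  have hα30 : 0 ≤ α ^ 3 := pow_nonneg hα0 3
  have hα4 : α ^ 4 ≤ α ^ 3 * (1 / 64) := by
    calc α ^ 4 = α ^ 3 * α := by ring
      _ ≤ α ^ 3 * (1 / 64) := by gcongr
  have hKt : K * t ≤ α ^ 3 * y ^ 3 := by
    calc K * t ≤ (α * y) * (α ^ 2 * y ^ 2) := mul_le_mul hK ht t.coe_nonneg (by positivity)
      _ = α ^ 3 * y ^ 3 := by ring
  have hxW : |Z.re + W t| ≤ 3 * α ^ 3 * y := by
    rw [hre, show -(2 / y ^ 2) * J + E₂.re - W t + W t = -(2 / y ^ 2) * J + E₂.re by ring]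
    calc |-(2 / y ^ 2) * J + E₂.re| ≤ |-(2 / y ^ 2) * J| + |E₂.re| := abs_add_le _ _
      _ ≤ 2 / y ^ 2 * (K * t) + 32 * α ^ 4 * y := by
          gcongr
          · rw [abs_mul, abs_neg, abs_of_pos (by positivity)]; gcongr
          · exact (abs_re_le_norm _).trans hE₂
      _ ≤ 2 / y ^ 2 * (α ^ 3 * y ^ 3) + 32 * (α ^ 3 * (1 / 64)) * y := by gcongr
      _ = (5 / 2) * α ^ 3 * y := by field_simp; ring
      _ ≤ 3 * α ^ 3 * y := by nlinarith
  -- the modulus of the centred point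
  have hZy : |‖Z‖ - y| ≤ 2 * α * y := by
    have h1 : ‖Z - I * y‖ ≤ 2 * α * y := by
      rw [hZ, show g t - (W t : ℂ) - I * y = (g t - I * y) - W t by ring]
      calc ‖g t - I * y - (W t : ℂ)‖ ≤ ‖g t - I * y‖ + ‖(W t : ℂ)‖ := norm_sub_le _ _
        _ ≤ 8 / y * t + K := by
            gcongr
            rw [norm_real, Real.norm_eq_abs]; exact hWt
        _ ≤ 8 / y * (α ^ 2 * y ^ 2) + α * y := by gcongr
        _ = (8 * α ^ 2 + α) * y := by field_simp
        _ ≤ 2 * α * y := by nlinarith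
    have h2 := abs_norm_sub_norm_le Z (I * y)
    rw [hnorm] at h2
    exact h2.trans h1
  have hZy' := abs_le.1 hZy
  have hZpos : y / 2 ≤ ‖Z‖ := by nlinarith
  have hZ0 : 0 < ‖Z‖ := by linarith
  have hWy : |W t| ≤ α * y := hWt.trans hK
  constructor
  · have hid : Z.re / ‖Z‖ + W t / y = (Z.re + W t) / ‖Z‖ + W t * (‖Z‖ - y) / (y * ‖Z‖) := by
      field_simp; ring
    rw [hid]
    calc |(Z.re + W t) / ‖Z‖ + W t * (‖Z‖ - y) / (y * ‖Z‖)|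
        ≤ |(Z.re + W t) / ‖Z‖| + |W t * (‖Z‖ - y) / (y * ‖Z‖)| := abs_add_le _ _
      _ = |Z.re + W t| / ‖Z‖ + |W t| * |‖Z‖ - y| / (y * ‖Z‖) := by
          rw [abs_div, abs_of_pos hZ0, abs_div, abs_mul, abs_of_pos (by positivity : 0 < y * ‖Z‖)]
      _ ≤ 3 * α ^ 3 * y / (y / 2) + α * y * (2 * α * y) / (y * (y / 2)) := by
          gcongr
      _ = 6 * α ^ 3 + 4 * α ^ 2 := by field_simp; ring
      _ ≤ 5 * α ^ 2 := by nlinarith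
  · rw [abs_div, abs_of_pos hZ0, div_le_iff₀ hZ0]
    have h1 : |Z.re| ≤ |Z.re + W t| + |W t| := by
      calc |Z.re| = |(Z.re + W t) + (-W t)| := by ring_nf
        _ ≤ |Z.re + W t| + |-W t| := abs_add_le _ _
        _ = |Z.re + W t| + |W t| := by rw [abs_neg]
    have hα2' : α ^ 2 ≤ α * (1 / 64) := by
      calc α ^ 2 = α * α := by ring
        _ ≤ α * (1 / 64) := by gcongr
    calc |Z.re| ≤ 3 * α ^ 3 * y + α * y := h1.trans (add_le_add hxW hWy)
      _ ≤ 2 * α * (y - 2 * α * y) := by nlinarith [mul_nonneg hα0 hy.le, mul_nonneg hα30 hy.le]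
      _ ≤ 2 * α * ‖Z‖ := by gcongr; linarith

/-- **The room–entropy combination at `iy` to second order.** With `ψ_t = Loewner.derivRatio`,
`S_t = Loewner.schrammObs` and `H = Real.binEntropy`:
`|log ψ_t(iy) + 3 H(S_t(iy)) - 3 log 2 - (4t - (3/2) W_t²)/y²| ≤ 140 α³` in the far-field regime
at `iy`. The coefficient `-3/2` of `W_t²` is `½ Λ''(π/2)` for the profile `Λ(θ) = 3 H(sin²(θ/2))`,
and `4 - (3/2) κ = 0` singles out `κ = 8/3`. [folklore] -/
theorem abs_roomObs_I_sub_le (h : FarRegime W (I * y) t K) (hy : 0 < y) :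
    |Real.log (derivRatio W (I * y) t) + 3 * Real.binEntropy (schrammObs W (I * y) t) -
        3 * Real.log 2 - (4 * t - 3 / 2 * W t ^ 2) / y ^ 2| ≤ 140 * ((K + Real.sqrt t) / y) ^ 3 := by
  have hlog := h.abs_log_derivRatio_sub_le hy
  obtain ⟨hc1, hc2⟩ := h.abs_cos_centredMap_I_add_le hy
  have hnorm := norm_I_mul hy
  have hK := h.K_le
  have hα := h.alpha_le
  have hα0 := h.alpha_nonneg
  have hWt := h.abs_driver_le
  rw [hnorm] at hK hα hα0
  set α := (K + Real.sqrt t) / y with hαdef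
  set c := (centredMap W t (I * y)).re / ‖centredMap W t (I * y)‖ with hcdef
  have hS : schrammObs W (I * y) t = (1 + c) / 2 := rfl
  have hα2 : α ^ 2 ≤ (1 / 64) ^ 2 := pow_le_pow_left₀ hα0 hα 2
  have hα30 : 0 ≤ α ^ 3 := pow_nonneg hα0 3
  have hcabs : |c| ≤ 1 / 2 := hc2.trans (by linarith)
  have hH := three_mul_binEntropy_half_add c (lt_of_le_of_lt hcabs (by norm_num))
  have hf := abs_symmMulLog_sub_sq_le hcabs
  have hWy : |W t / y| ≤ α := by
    rw [abs_div, abs_of_pos hy, div_le_iff₀ hy]; exact hWt.trans hK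
  -- `c² = (W_t/y)² + O(α³)`
  have hsq : |c ^ 2 - (W t / y) ^ 2| ≤ 15 * α ^ 3 := by
    have hid : c ^ 2 - (W t / y) ^ 2 = (c + W t / y) * (c - W t / y) := by ring
    rw [hid, abs_mul]
    have h2 : |c - W t / y| ≤ 3 * α := by
      calc |c - W t / y| ≤ |c| + |W t / y| := abs_sub _ _
        _ ≤ 2 * α + α := add_le_add hc2 hWy
        _ = 3 * α := by ring
    calc |c + W t / y| * |c - W t / y| ≤ 5 * α ^ 2 * (3 * α) :=
          mul_le_mul hc1 h2 (abs_nonneg _) (by positivity)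
      _ = 15 * α ^ 3 := by ring
  have hc3 : |c| ^ 3 ≤ 8 * α ^ 3 := by
    calc |c| ^ 3 ≤ (2 * α) ^ 3 := pow_le_pow_left₀ (abs_nonneg _) hc2 3
      _ = 8 * α ^ 3 := by ring
  rw [hS, hH]
  have hid : Real.log (derivRatio W (I * y) t) +
        (3 * Real.log 2 - 3 / 2 * ((1 + c) * Real.log (1 + c) + (1 - c) * Real.log (1 - c))) -
        3 * Real.log 2 - (4 * t - 3 / 2 * W t ^ 2) / y ^ 2 =
      (Real.log (derivRatio W (I * y) t) - 4 * t / y ^ 2) -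
        3 / 2 * (((1 + c) * Real.log (1 + c) + (1 - c) * Real.log (1 - c) - c ^ 2) +
          (c ^ 2 - (W t / y) ^ 2)) := by
    field_simp; ring
  rw [hid]
  calc |(Real.log (derivRatio W (I * y) t) - 4 * t / y ^ 2) -
        3 / 2 * (((1 + c) * Real.log (1 + c) + (1 - c) * Real.log (1 - c) - c ^ 2) +
          (c ^ 2 - (W t / y) ^ 2))|
      ≤ |Real.log (derivRatio W (I * y) t) - 4 * t / y ^ 2| +
        |3 / 2 * (((1 + c) * Real.log (1 + c) + (1 - c) * Real.log (1 - c) - c ^ 2) +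
          (c ^ 2 - (W t / y) ^ 2))| := abs_sub _ _
    _ ≤ 13 * α ^ 3 + 3 / 2 * (8 * |c| ^ 3 + 15 * α ^ 3) := by
        gcongr
        rw [abs_mul, abs_of_pos (by norm_num : (0 : ℝ) < 3 / 2)]
        gcongr
        exact (abs_add_le _ _).trans (add_le_add hf hsq)
    _ ≤ 13 * α ^ 3 + 3 / 2 * (8 * (8 * α ^ 3) + 15 * α ^ 3) := by gcongr
    _ ≤ 140 * α ^ 3 := by nlinarith

end ImagAxis

/-! #### The point `y (3 + 4i)/5` off the axis: first order -/

section OffAxis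

variable {y : ℝ}

/-- `‖3 + 4i‖ = 5`. [folklore] -/
theorem norm_three_add_four_I : ‖(3 + 4 * I : ℂ)‖ = 5 := by
  rw [Complex.norm_eq_sqrt_sq_add_sq]
  simp only [add_re, re_ofNat, mul_re, im_ofNat, I_re, mul_zero, I_im, mul_one, sub_self,
    add_zero, add_im, mul_im, zero_add]
  rw [show (3 : ℝ) ^ 2 + 4 ^ 2 = 5 ^ 2 by norm_num, Real.sqrt_sq (by norm_num)]

/-- `‖y (3 + 4i)/5‖ = y` for `y > 0`. [folklore] -/
theorem norm_offAxis (hy : 0 < y) : ‖(y * (3 + 4 * I) / 5 : ℂ)‖ = y := by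
  rw [norm_div, norm_mul, norm_three_add_four_I, norm_real, Real.norm_eq_abs, abs_of_pos hy]
  simp

/-- `Re (y (3 + 4i)/5) = 3y/5`, `Im (y (3 + 4i)/5) = 4y/5`. [folklore] -/
theorem re_im_offAxis (y : ℝ) :
    (y * (3 + 4 * I) / 5 : ℂ).re = 3 * y / 5 ∧ (y * (3 + 4 * I) / 5 : ℂ).im = 4 * y / 5 := by
  have h : (y * (3 + 4 * I) / 5 : ℂ) = ((3 * y / 5 : ℝ) : ℂ) + ((4 * y / 5 : ℝ) : ℂ) * I := by
    push_cast; ring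
  rw [h]
  constructor
  · simp
  · simp

/-- **Schramm's cosine at `w = y(3+4i)/5` to first order**: with `c_t = Re z_t/|z_t|` and
`ω = W_t/y`, `|c_t - (3/5 - (16/25) ω)| ≤ 21 α²` (`z_t = w - W_t + O(α² y)`, the direction map is
`2/|·|`-Lipschitz, and `cos arg(w - W_t) = 3/5 - (16/25) ω + O(ω²)`). [folklore] -/
theorem abs_cos_centredMap_offAxis_sub_le (h : FarRegime W (y * (3 + 4 * I) / 5) t K) (hy : 0 < y) :
    |(centredMap W t (y * (3 + 4 * I) / 5)).re / ‖centredMap W t (y * (3 + 4 * I) / 5)‖ -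
        (3 / 5 - 16 / 25 * (W t / y))| ≤ 21 * ((K + Real.sqrt t) / y) ^ 2 := by
  have hnorm := norm_offAxis hy
  obtain ⟨hwre, hwim⟩ := re_im_offAxis y
  have hK := h.K_le
  have hα := h.alpha_le
  have hα0 := h.alpha_nonneg
  have hmove := h.norm_centredMap_sub_le
  have hWt := h.abs_driver_le
  rw [hnorm] at hK hα hα0 hmove
  set α := (K + Real.sqrt t) / y with hαdef
  set w : ℂ := y * (3 + 4 * I) / 5 with hwdef
  set Z := centredMap W t w with hZdef
  set Z' : ℂ := w - W t with hZ'def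
  have hZ're : Z'.re = 3 * y / 5 - W t := by rw [hZ'def, sub_re, hwre, ofReal_re]
  have hZ'im : Z'.im = 4 * y / 5 := by rw [hZ'def, sub_im, hwim, ofReal_im, sub_zero]
  have hZ'n : 4 * y / 5 ≤ ‖Z'‖ := by
    have := abs_im_le_norm Z'
    rwa [hZ'im, abs_of_pos (by positivity)] at this
  have hZ'0 : Z' ≠ 0 := by
    intro h0; rw [h0, norm_zero] at hZ'n; linarith
  have hZ'pos : 0 < ‖Z'‖ := norm_pos_iff.2 hZ'0
  -- Lipschitz step
  have h1 : |Z.re / ‖Z‖ - Z'.re / ‖Z'‖| ≤ 20 * α ^ 2 := by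
    calc |Z.re / ‖Z‖ - Z'.re / ‖Z'‖| ≤ 2 * ‖Z - Z'‖ / ‖Z'‖ := abs_re_div_norm_sub_le Z hZ'0
      _ ≤ 2 * (8 * α ^ 2 * y) / (4 * y / 5) := by
          gcongr
      _ = 20 * α ^ 2 := by field_simp; ring
  -- the explicit cosine
  set ω : ℝ := W t / y with hωdef
  have hω : |ω| ≤ 1 / 64 := by
    rw [hωdef, abs_div, abs_of_pos hy, div_le_iff₀ hy]
    calc |W t| ≤ α * y := hWt.trans hK
      _ ≤ 1 / 64 * y := by gcongr
  have hωα : |ω| ≤ α := by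
    rw [hωdef, abs_div, abs_of_pos hy, div_le_iff₀ hy]; exact hWt.trans hK
  have hcos : Z'.re / ‖Z'‖ = (3 / 5 - ω) / Real.sqrt ((3 / 5 - ω) ^ 2 + (4 / 5) ^ 2) := by
    have hn : ‖Z'‖ = y * Real.sqrt ((3 / 5 - ω) ^ 2 + (4 / 5) ^ 2) := by
      rw [Complex.norm_eq_sqrt_sq_add_sq, hZ're, hZ'im]
      have : (3 * y / 5 - W t) ^ 2 + (4 * y / 5) ^ 2 = y ^ 2 * ((3 / 5 - ω) ^ 2 + (4 / 5) ^ 2) := by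
        rw [hωdef]; field_simp
      rw [this, Real.sqrt_mul (sq_nonneg y), Real.sqrt_sq hy.le]
    have hs0 : 0 < Real.sqrt ((3 / 5 - ω) ^ 2 + (4 / 5) ^ 2) := Real.sqrt_pos.2 (by positivity)
    rw [hn, hZ're, show 3 * y / 5 - W t = y * (3 / 5 - ω) by rw [hωdef]; field_simp]
    field_simp
  have h2 := abs_cos_dir_sub_le hω
  rw [← hcos] at h2
  have hω2 : ω ^ 2 ≤ α ^ 2 := by
    rw [← sq_abs]; exact pow_le_pow_left₀ (abs_nonneg _) hωα 2
  calc |Z.re / ‖Z‖ - (3 / 5 - 16 / 25 * ω)|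
      = |(Z.re / ‖Z‖ - Z'.re / ‖Z'‖) + (Z'.re / ‖Z'‖ - (3 / 5 - 16 / 25 * ω))| := by ring_nf
    _ ≤ |Z.re / ‖Z‖ - Z'.re / ‖Z'‖| + |Z'.re / ‖Z'‖ - (3 / 5 - 16 / 25 * ω)| := abs_add_le _ _
    _ ≤ 20 * α ^ 2 + ω ^ 2 := add_le_add h1 h2
    _ ≤ 21 * α ^ 2 := by linarith

/-- **The room–entropy combination at `w = y(3+4i)/5` to first order.** With
`ψ_t = Loewner.derivRatio`, `S_t = Loewner.schrammObs`, `H = Real.binEntropy`: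
`|log ψ_t(w) + 3 H(S_t(w)) - 3 H(4/5) - (24 log 4/25) W_t/y| ≤ 130 α²` in the far-field regime at
`w` (`S_0 = 4/5`; the coefficient `(24/25) log 4 = Λ'(θ₀) sin θ₀` with `cos θ₀ = 3/5` is nonzero,
which is what makes the driver itself a local martingale). [folklore] -/
theorem abs_roomObs_offAxis_sub_le (h : FarRegime W (y * (3 + 4 * I) / 5) t K) (hy : 0 < y) :
    |Real.log (derivRatio W (y * (3 + 4 * I) / 5) t) +
        3 * Real.binEntropy (schrammObs W (y * (3 + 4 * I) / 5) t) -
        3 * Real.binEntropy (4 / 5) - 24 / 25 * Real.log 4 * (W t / y)| ≤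
      130 * ((K + Real.sqrt t) / y) ^ 2 := by
  have hc := h.abs_cos_centredMap_offAxis_sub_le hy
  have hnorm := norm_offAxis hy
  obtain ⟨-, hwim⟩ := re_im_offAxis y
  have him2 : ‖(y * (3 + 4 * I) / 5 : ℂ)‖ / 2 ≤ (y * (3 + 4 * I) / 5 : ℂ).im := by
    rw [hnorm, hwim]; linarith
  have hlog0 := h.log_derivRatio_nonneg (by rw [hwim]; positivity)
  have hlog1 := h.log_derivRatio_le him2
  have hK := h.K_le
  have hα := h.alpha_le
  have hα0 := h.alpha_nonneg
  have hWt := h.abs_driver_le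
  rw [hnorm] at hK hα hα0 hlog1
  -- name the pieces
  generalize hαdef : (K + Real.sqrt t) / y = α at hc hK hα hα0 hlog1
  generalize hLdef : Real.log (derivRatio W (y * (3 + 4 * I) / 5) t) = L at hlog0 hlog1
  have hS : schrammObs W (y * (3 + 4 * I) / 5) t =
      (1 + (centredMap W t (y * (3 + 4 * I) / 5)).re / ‖centredMap W t (y * (3 + 4 * I) / 5)‖) / 2 :=
    rfl
  rw [hS]
  generalize hcdef : (centredMap W t (y * (3 + 4 * I) / 5)).re /
    ‖centredMap W t (y * (3 + 4 * I) / 5)‖ = c at hc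
  generalize hωdef : W t / y = ω at hc
  have hωα : |ω| ≤ α := by
    rw [← hωdef, abs_div, abs_of_pos hy, div_le_iff₀ hy]; exact hWt.trans hK
  -- `c = 3/5 + e`, `|e| ≤ α ≤ 1/5`
  obtain ⟨e, hce⟩ : ∃ e : ℝ, c = 3 / 5 + e := ⟨c - 3 / 5, by ring⟩
  rw [hce] at hc ⊢
  have heω : |e + 16 / 25 * ω| ≤ 21 * α ^ 2 := by
    rw [show e + 16 / 25 * ω = 3 / 5 + e - (3 / 5 - 16 / 25 * ω) by ring]; exact hc
  have hωα' := abs_le.1 hωα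
  have heω' := abs_le.1 heω
  have hα2 : α ^ 2 ≤ α * (1 / 64) := by
    calc α ^ 2 = α * α := by ring
      _ ≤ α * (1 / 64) := by gcongr
  have he : |e| ≤ α := by
    rw [abs_le]; constructor <;> nlinarith
  have he5 : |e| ≤ 1 / 5 := he.trans (by linarith)
  have he' := abs_le.1 he5
  have hcabs : |3 / 5 + e| < 1 := by
    rw [abs_lt]; constructor <;> linarith
  have hH := three_mul_binEntropy_half_add (3 / 5 + e) hcabs
  have hH0 := three_mul_binEntropy_half_add (3 / 5 : ℝ) (by rw [abs_of_pos (by norm_num)]; norm_num)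
  rw [show ((1 : ℝ) + 3 / 5) / 2 = 4 / 5 by norm_num] at hH0
  obtain ⟨hf0, hf1⟩ := symmMulLog_three_fifths_expansion he5
  have hlog4 : 0 ≤ Real.log 4 := Real.log_nonneg (by norm_num)
  have hlog4' : Real.log 4 ≤ 3 := (Real.log_le_sub_one_of_pos (by norm_num)).trans (by norm_num)
  rw [hH, hH0]
  generalize hFdef : (1 + (3 / 5 + e)) * Real.log (1 + (3 / 5 + e)) +
    (1 - (3 / 5 + e)) * Real.log (1 - (3 / 5 + e)) = F at hf0 hf1
  have hF0 : (1 + (3 / 5 : ℝ)) * Real.log (1 + 3 / 5) + (1 - 3 / 5) * Real.log (1 - 3 / 5) =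
      (8 / 5 : ℝ) * Real.log (8 / 5) + (2 / 5 : ℝ) * Real.log (2 / 5) := by norm_num
  rw [hF0]
  generalize hF0def : (8 / 5 : ℝ) * Real.log (8 / 5) + (2 / 5 : ℝ) * Real.log (2 / 5) = F0 at hf0 hf1
  -- `F - F0 = e log 4 + ρ`, `0 ≤ ρ ≤ (25/8) e²`
  obtain ⟨ρ, hρ⟩ : ∃ ρ : ℝ, F = F0 + e * Real.log 4 + ρ := ⟨F - F0 - e * Real.log 4, by ring⟩
  rw [hρ] at hf0 hf1 ⊢
  have hρ0 : 0 ≤ ρ := by linarith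
  have hρ1 : ρ ≤ 25 / 8 * e ^ 2 := by linarith
  have he2 : e ^ 2 ≤ α ^ 2 := by
    rw [← sq_abs]; exact pow_le_pow_left₀ (abs_nonneg _) he 2
  have hid : L + (3 * Real.log 2 - 3 / 2 * (F0 + e * Real.log 4 + ρ)) - (3 * Real.log 2 - 3 / 2 * F0) -
      24 / 25 * Real.log 4 * ω = L - 3 / 2 * ρ - 3 / 2 * Real.log 4 * (e + 16 / 25 * ω) := by ring
  rw [hid]
  calc |L - 3 / 2 * ρ - 3 / 2 * Real.log 4 * (e + 16 / 25 * ω)|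
      ≤ |L - 3 / 2 * ρ| + |3 / 2 * Real.log 4 * (e + 16 / 25 * ω)| := abs_sub _ _
    _ ≤ (|L| + |3 / 2 * ρ|) + |3 / 2 * Real.log 4 * (e + 16 / 25 * ω)| := by
        gcongr; exact abs_sub _ _
    _ = L + 3 / 2 * ρ + 3 / 2 * Real.log 4 * |e + 16 / 25 * ω| := by
        rw [abs_of_nonneg hlog0, abs_of_nonneg (by positivity), abs_mul,
          abs_of_nonneg (by positivity)]
    _ ≤ 20 * α ^ 2 + 3 / 2 * (25 / 8 * e ^ 2) + 3 / 2 * Real.log 4 * (21 * α ^ 2) := by gcongr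
    _ ≤ 20 * α ^ 2 + 3 / 2 * (25 / 8 * α ^ 2) + 3 / 2 * 3 * (21 * α ^ 2) := by
        gcongr
    _ ≤ 130 * α ^ 2 := by nlinarith [sq_nonneg α]

end OffAxis

/-! #### The room stop does not bite in the far field -/

/-- **In the far-field regime the room stop has not occurred by time `t`**: if `Im z ≥ ‖z‖/2`,
`m ≥ 1` and `t ≤ m + 1`, then `t ≤ τ^{z,m} := inf ({u | Im z_u ≤ Im z/(m+1)} ∪ {m+1})`, because
`Im z_u ≥ Im z - 8u/‖z‖ > Im z/2` for `u ≤ t`. [folklore] -/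
theorem le_roomStop (h : FarRegime W z t K) (hz : ‖z‖ / 2 ≤ z.im) {m : ℕ} (hm : 1 ≤ m)
    (htm : (t : ℝ) ≤ m + 1) :
    t ≤ sInf ({u : ℝ≥0 | (centredMap W u z).im ≤ z.im / ((m : ℝ) + 1)} ∪ {(m : ℝ≥0) + 1}) := by
  have hα := h.alpha_le
  have hα0 := h.alpha_nonneg
  have ht := h.t_le
  have hρ := h.pos
  set α := (K + Real.sqrt t) / ‖z‖ with hαdef
  have hzim : 0 < z.im := by linarith
  refine le_csInf ⟨(m : ℝ≥0) + 1, Or.inr rfl⟩ ?_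
  rintro u (hu | hu)
  · by_contra hlt
    rw [not_le] at hlt
    have hflow := (h.flow.2 u hlt.le).2
    have h1 : |(map W u z - z).im| ≤ ‖map W u z - z‖ := abs_im_le_norm _
    rw [sub_im] at h1
    have h2 : ‖map W u z - z‖ ≤ 8 * α ^ 2 * ‖z‖ := by
      calc ‖map W u z - z‖ ≤ 8 / ‖z‖ * u := hflow
        _ ≤ 8 / ‖z‖ * t := by gcongr
        _ ≤ 8 / ‖z‖ * (α ^ 2 * ‖z‖ ^ 2) := by gcongr
        _ = 8 * α ^ 2 * ‖z‖ := by field_simp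
    have h3 := (abs_le.1 (h1.trans h2)).1
    have hα2 : α ^ 2 ≤ (1 / 64) ^ 2 := pow_le_pow_left₀ hα0 hα 2
    have hm1 : z.im / ((m : ℝ) + 1) ≤ z.im / 2 := by
      apply div_le_div_of_nonneg_left hzim.le (by norm_num)
      have : (1 : ℝ) ≤ m := by exact_mod_cast hm
      linarith
    have hmem : (centredMap W u z).im ≤ z.im / ((m : ℝ) + 1) := hu
    rw [im_centredMap] at hmem
    nlinarith
  · rw [mem_singleton_iff] at hu
    rw [hu, ← NNReal.coe_le_coe]
    push_cast
    exact htm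

end FarRegime

/-! ### Continuity in time of the stopped room–entropy combination -/

section Continuity

variable {W : ℝ≥0 → ℝ} {z : ℂ}

/-- **The stopped room–entropy combination `t ↦ log ψ_{t∧τ} + 3 H(S_{t∧τ})` is continuous** for
every continuous driving function and `z ∈ ℍ`, where `τ = τ^{z,m}` is the room stop: `τ` is a
finite time strictly before the swallowing time `T_z` (if `T_z < ∞` then `Im z_t → 0` as
`t ↑ T_z`, `Loewner.exists_forall_im_centredMap_lt`), and on `[0, τ] ⊂ [0, T_z)` the ratio
`ψ_t = exp ∫₀ᵗ 4y²/|z|⁴` (Rohde–Schramm (6.3)) and `S_t` are continuous. [folklore] -/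
theorem continuous_roomObs_min (hW : Continuous W) (hz : 0 < z.im) (m : ℕ) :
    Continuous fun r : ℝ≥0 ↦
      Real.log (derivRatio W z (min r (sInf ({u : ℝ≥0 | (centredMap W u z).im ≤ z.im / ((m : ℝ) + 1)} ∪
          {(m : ℝ≥0) + 1})))) +
        3 * Real.binEntropy (schrammObs W z (min r (sInf ({u : ℝ≥0 |
          (centredMap W u z).im ≤ z.im / ((m : ℝ) + 1)} ∪ {(m : ℝ≥0) + 1})))) := by
  set τ := sInf ({u : ℝ≥0 | (centredMap W u z).im ≤ z.im / ((m : ℝ) + 1)} ∪ {(m : ℝ≥0) + 1})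
    with hτdef
  -- `τ` is strictly before the swallowing time
  have hτT : (τ : WithTop ℝ≥0) < swallowingTime W z := by
    cases hT : swallowingTime W z with
    | top => exact WithTop.coe_lt_top τ
    | coe b =>
      have hε : 0 < z.im / ((m : ℝ) + 1) := by positivity
      obtain ⟨t₀, ht₀T, ht₀⟩ := exists_forall_im_centredMap_lt hW hz hT hε
      have hlt := ht₀ t₀ le_rfl ht₀T
      rw [hT] at ht₀T
      have hmem : t₀ ∈ {u : ℝ≥0 | (centredMap W u z).im ≤ z.im / ((m : ℝ) + 1)} ∪ {(m : ℝ≥0) + 1} :=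
        Or.inl hlt.le
      exact lt_of_le_of_lt (WithTop.coe_le_coe.2 (csInf_le (OrderBot.bddBelow _) hmem)) ht₀T
  have hzW : z ≠ W 0 := ne_driving_of_im_pos hz 0
  have hsub : Icc (0 : ℝ≥0) τ ⊆ {r | (r : WithTop ℝ≥0) < swallowingTime W z} := fun r hr ↦
    lt_of_le_of_lt (WithTop.coe_le_coe.2 hr.2) hτT
  -- the centred flow
  have hZc : ContinuousOn (fun r : ℝ≥0 ↦ centredMap W r z) (Icc 0 τ) :=
    (continuousOn_centredMap hW hzW).mono hsub
  have hZ0 : ∀ r ∈ Icc (0 : ℝ≥0) τ, centredMap W r z ≠ 0 := fun r hr ↦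
    centredMap_ne_zero hW hz (hsub hr)
  -- Schramm's observable
  have hSc : ContinuousOn (schrammObs W z) (Icc 0 τ) := by
    have hS : schrammObs W z = fun r ↦ (1 + (centredMap W r z).re / ‖centredMap W r z‖) / 2 := rfl
    rw [hS]
    refine (continuousOn_const.add ((continuous_re.comp_continuousOn hZc).div hZc.norm ?_)).div_const _
    exact fun r hr ↦ norm_ne_zero_iff.2 (hZ0 r hr)
  -- the ratio `ψ`
  have hrate : ContinuousOn (derivRatioRate W z) (Icc (0 : ℝ) τ) :=
    continuousOn_derivRatioRate hW (b := (τ : ℝ)) (by rw [Real.toNNReal_coe]; exact hτT)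
  have hprim : ContinuousOn (fun x : ℝ ↦ ∫ s in (0 : ℝ)..x, derivRatioRate W z s) (Icc (0 : ℝ) τ) := by
    have h1 := intervalIntegral.continuousOn_primitive_interval (μ := volume)
      (f := derivRatioRate W z) (a := 0) (b := (τ : ℝ)) ?_
    · rwa [uIcc_of_le τ.coe_nonneg] at h1
    · rw [uIcc_of_le τ.coe_nonneg]
      exact hrate.integrableOn_compact isCompact_Icc
  have hψc : ContinuousOn (derivRatio W z) (Icc 0 τ) := by
    have h1 : ContinuousOn (fun r : ℝ≥0 ↦ Real.exp (∫ s in (0 : ℝ)..(r : ℝ), derivRatioRate W z s))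
        (Icc 0 τ) :=
      Real.continuous_exp.comp_continuousOn (hprim.comp NNReal.continuous_coe.continuousOn
        fun r hr ↦ ⟨r.coe_nonneg, NNReal.coe_le_coe.2 hr.2⟩)
    exact h1.congr fun r hr ↦ derivRatio_eq_exp hW hz (hsub hr)
  have hψ0 : ∀ r ∈ Icc (0 : ℝ≥0) τ, derivRatio W z r ≠ 0 := fun r hr ↦
    (lt_of_lt_of_le one_pos (one_le_derivRatio hW hz (hsub hr))).ne'
  have hN : ContinuousOn
      (fun r ↦ Real.log (derivRatio W z r) + 3 * Real.binEntropy (schrammObs W z r)) (Icc 0 τ) :=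
    (hψc.log hψ0).add (continuousOn_const.mul (Real.binEntropy_continuous.comp_continuousOn hSc))
  have hmin : Continuous fun r : ℝ≥0 ↦ min r τ := continuous_id.min continuous_const
  exact hN.comp_continuous hmin fun r ↦ ⟨bot_le, min_le_right _ _⟩

end Continuity

/-! ### The two approximation statements consumed by the probabilistic half -/

section Packaged

/-- Far-field regime from a pointwise driver bound on `[0, r]`. [folklore] -/
theorem farRegime_of_bound {W : ℝ≥0 → ℝ} (hW : Continuous W) {K : ℝ} {r : ℝ≥0} {z : ℂ}
    (hbd : ∀ u, u ≤ r → |W u| ≤ K) (hfar : 64 * (K + Real.sqrt r) ≤ ‖z‖) (hpos : 0 < ‖z‖) :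
    FarRegime W z r K :=
  ⟨hW, fun u hu ↦ hbd _ (by
    have := Real.toNNReal_le_toNNReal hu.2
    rwa [Real.toNNReal_coe] at this), hfar, hpos⟩

/-- **Order one (the driver).** For every driver bound `K ≥ 0`, horizon `T` and `ε > 0` there are a
level `y > 0` and a cap `m` such that, for EVERY continuous driving function `W` and every time
`r ≤ T` with `|W| ≤ K` on `[0, r]`, the room–entropy combination at `w = y(3+4i)/5` stopped at the
room stop `τ^{w,m}` satisfies `|N^{w,m}_r - (a W_r + 3 H(4/5))| ≤ ε |a|` with the nonzero
constant `a = (24 log 4/25)/y` (far-field expansion `abs_roomObs_offAxis_sub_le` + `le_roomStop`).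
[folklore] -/
theorem exists_level_roomObs_order_one {K : ℝ} (hK : 0 ≤ K) (T : ℝ≥0) {ε : ℝ} (hε : 0 < ε) :
    ∃ (y : ℝ) (m : ℕ), 0 < y ∧ ∀ (W : ℝ≥0 → ℝ), Continuous W → ∀ r : ℝ≥0, r ≤ T →
      (∀ u, u ≤ r → |W u| ≤ K) →
      |Real.log (derivRatio W (y * (3 + 4 * I) / 5) (min r (sInf ({u : ℝ≥0 |
            (centredMap W u (y * (3 + 4 * I) / 5)).im ≤ (y * (3 + 4 * I) / 5 : ℂ).im / ((m : ℝ) + 1)} ∪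
            {(m : ℝ≥0) + 1})))) +
          3 * Real.binEntropy (schrammObs W (y * (3 + 4 * I) / 5) (min r (sInf ({u : ℝ≥0 |
            (centredMap W u (y * (3 + 4 * I) / 5)).im ≤ (y * (3 + 4 * I) / 5 : ℂ).im / ((m : ℝ) + 1)} ∪
            {(m : ℝ≥0) + 1})))) -
          (24 / 25 * Real.log 4 / y * W r + 3 * Real.binEntropy (4 / 5))| ≤
        ε * |24 / 25 * Real.log 4 / y| := by
  set M := K + Real.sqrt T with hMdef
  have hM0 : 0 ≤ M := add_nonneg hK (Real.sqrt_nonneg _)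
  have hlog4 : 0 < Real.log 4 := Real.log_pos (by norm_num)
  set y : ℝ := max (64 * M) (130 * M ^ 2 * 25 / (24 * Real.log 4 * ε)) + 1 with hydef
  set m : ℕ := ⌈(T : ℝ)⌉₊ + 1 with hmdef
  have hy64' : 64 * M + 1 ≤ y := by
    have := le_max_left (64 * M) (130 * M ^ 2 * 25 / (24 * Real.log 4 * ε))
    rw [hydef]; linarith
  have hy64 : 64 * M ≤ y := by linarith
  have hy2 : 130 * M ^ 2 * 25 / (24 * Real.log 4 * ε) ≤ y :=
    (le_max_right _ _).trans (by rw [hydef]; linarith)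
  have hy : 0 < y := by
    have : (0 : ℝ) ≤ 64 * M := by positivity
    linarith
  refine ⟨y, m, hy, fun W hW r hr hbd ↦ ?_⟩
  have hnorm := FarRegime.norm_offAxis hy
  obtain ⟨-, hwim⟩ := FarRegime.re_im_offAxis y
  have hrT : Real.sqrt r ≤ Real.sqrt T := Real.sqrt_le_sqrt (NNReal.coe_le_coe.2 hr)
  have hreg : FarRegime W (y * (3 + 4 * I) / 5) r K :=
    farRegime_of_bound hW hbd (by rw [hnorm]; linarith) (by rw [hnorm]; exact hy)
  have him2 : ‖(y * (3 + 4 * I) / 5 : ℂ)‖ / 2 ≤ (y * (3 + 4 * I) / 5 : ℂ).im := by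
    rw [hnorm, hwim]; linarith
  have htm : (r : ℝ) ≤ m + 1 := by
    have h1 : ((r : ℝ≥0) : ℝ) ≤ T := NNReal.coe_le_coe.2 hr
    have h2 : (T : ℝ) ≤ ⌈(T : ℝ)⌉₊ := Nat.le_ceil _
    rw [hmdef]; push_cast; linarith
  have hstop := hreg.le_roomStop him2 (by rw [hmdef]; exact Nat.le_add_left 1 _) htm
  rw [min_eq_left hstop]
  have hexp := hreg.abs_roomObs_offAxis_sub_le hy
  have hid : Real.log (derivRatio W (y * (3 + 4 * I) / 5) r) +
        3 * Real.binEntropy (schrammObs W (y * (3 + 4 * I) / 5) r) -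
        (24 / 25 * Real.log 4 / y * W r + 3 * Real.binEntropy (4 / 5)) =
      Real.log (derivRatio W (y * (3 + 4 * I) / 5) r) +
        3 * Real.binEntropy (schrammObs W (y * (3 + 4 * I) / 5) r) -
        3 * Real.binEntropy (4 / 5) - 24 / 25 * Real.log 4 * (W r / y) := by
    field_simp; ring
  rw [hid]
  refine hexp.trans ?_
  have ha : |24 / 25 * Real.log 4 / y| = 24 / 25 * Real.log 4 / y := abs_of_pos (by positivity)
  rw [ha]
  have hKr : K + Real.sqrt r ≤ M := by rw [hMdef]; linarith
  have h1 : (K + Real.sqrt r) / y ≤ M / y := by gcongr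
  have h0 : 0 ≤ (K + Real.sqrt r) / y := by positivity
  calc 130 * ((K + Real.sqrt r) / y) ^ 2 ≤ 130 * (M / y) ^ 2 := by gcongr
    _ = (130 * M ^ 2 / y) / y := by field_simp
    _ ≤ (ε * (24 / 25 * Real.log 4)) / y := by
        gcongr
        rw [div_le_iff₀ hy]
        have := (div_le_iff₀ (by positivity : (0 : ℝ) < 24 * Real.log 4 * ε)).1 hy2
        nlinarith
    _ = ε * (24 / 25 * Real.log 4 / y) := by ring

/-- **Order two (the quadratic term).** For every `K ≥ 0`, `T` and `ε > 0` there are `y > 0` and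
`m` such that, for every continuous `W` and `r ≤ T` with `|W| ≤ K` on `[0, r]`, the room–entropy
combination at `iy` stopped at the room stop satisfies
`|N^{iy,m}_r - (a (W_r² - (8/3) r) + 3 log 2)| ≤ ε |a|`, `a = -(3/2)/y²` (far-field expansion
`abs_roomObs_I_sub_le`: `4r - (3/2) W_r² = -(3/2) (W_r² - (8/3) r)`, whence `κ = 8/3`).
[folklore] -/
theorem exists_level_roomObs_order_two {K : ℝ} (hK : 0 ≤ K) (T : ℝ≥0) {ε : ℝ} (hε : 0 < ε) :
    ∃ (y : ℝ) (m : ℕ), 0 < y ∧ ∀ (W : ℝ≥0 → ℝ), Continuous W → ∀ r : ℝ≥0, r ≤ T →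
      (∀ u, u ≤ r → |W u| ≤ K) →
      |Real.log (derivRatio W (I * y) (min r (sInf ({u : ℝ≥0 |
            (centredMap W u (I * y)).im ≤ (I * y : ℂ).im / ((m : ℝ) + 1)} ∪ {(m : ℝ≥0) + 1})))) +
          3 * Real.binEntropy (schrammObs W (I * y) (min r (sInf ({u : ℝ≥0 |
            (centredMap W u (I * y)).im ≤ (I * y : ℂ).im / ((m : ℝ) + 1)} ∪ {(m : ℝ≥0) + 1})))) -
          (-(3 / 2) / y ^ 2 * (W r ^ 2 - 8 / 3 * r) + 3 * Real.log 2)| ≤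
        ε * |-(3 / 2) / y ^ 2| := by
  set M := K + Real.sqrt T with hMdef
  have hM0 : 0 ≤ M := add_nonneg hK (Real.sqrt_nonneg _)
  set y : ℝ := max (64 * M) (140 * M ^ 3 * (2 / 3) / ε) + 1 with hydef
  set m : ℕ := ⌈(T : ℝ)⌉₊ + 1 with hmdef
  have hy64' : 64 * M + 1 ≤ y := by
    have := le_max_left (64 * M) (140 * M ^ 3 * (2 / 3) / ε)
    rw [hydef]; linarith
  have hy64 : 64 * M ≤ y := by linarith
  have hy2 : 140 * M ^ 3 * (2 / 3) / ε ≤ y := (le_max_right _ _).trans (by rw [hydef]; linarith)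
  have hy : 0 < y := by
    have : (0 : ℝ) ≤ 64 * M := by positivity
    linarith
  refine ⟨y, m, hy, fun W hW r hr hbd ↦ ?_⟩
  have hnorm := FarRegime.norm_I_mul hy
  have hwim : (I * y : ℂ).im = y := by simp
  have hrT : Real.sqrt r ≤ Real.sqrt T := Real.sqrt_le_sqrt (NNReal.coe_le_coe.2 hr)
  have hreg : FarRegime W (I * y) r K :=
    farRegime_of_bound hW hbd (by rw [hnorm]; linarith) (by rw [hnorm]; exact hy)
  have him2 : ‖(I * y : ℂ)‖ / 2 ≤ (I * y : ℂ).im := by rw [hnorm, hwim]; linarith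
  have htm : (r : ℝ) ≤ m + 1 := by
    have h1 : ((r : ℝ≥0) : ℝ) ≤ T := NNReal.coe_le_coe.2 hr
    have h2 : (T : ℝ) ≤ ⌈(T : ℝ)⌉₊ := Nat.le_ceil _
    rw [hmdef]; push_cast; linarith
  have hstop := hreg.le_roomStop him2 (by rw [hmdef]; exact Nat.le_add_left 1 _) htm
  rw [min_eq_left hstop]
  have hexp := hreg.abs_roomObs_I_sub_le hy
  have hy2' : y ^ 2 ≠ 0 := by positivity
  have hid : Real.log (derivRatio W (I * y) r) + 3 * Real.binEntropy (schrammObs W (I * y) r) -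
        (-(3 / 2) / y ^ 2 * (W r ^ 2 - 8 / 3 * r) + 3 * Real.log 2) =
      Real.log (derivRatio W (I * y) r) + 3 * Real.binEntropy (schrammObs W (I * y) r) -
        3 * Real.log 2 - (4 * r - 3 / 2 * W r ^ 2) / y ^ 2 := by
    field_simp; ring
  rw [hid]
  refine hexp.trans ?_
  have ha : |-(3 / 2) / y ^ 2| = 3 / 2 / y ^ 2 := by
    rw [abs_div, abs_neg, abs_of_pos (by norm_num : (0 : ℝ) < 3 / 2), abs_of_pos (by positivity)]
  rw [ha]
  have hKr : K + Real.sqrt r ≤ M := by rw [hMdef]; linarith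
  have h1 : (K + Real.sqrt r) / y ≤ M / y := by gcongr
  have h0 : 0 ≤ (K + Real.sqrt r) / y := by positivity
  calc 140 * ((K + Real.sqrt r) / y) ^ 3 ≤ 140 * (M / y) ^ 3 := by gcongr
    _ = (140 * M ^ 3 / y) / y ^ 2 := by field_simp
    _ ≤ (ε * (3 / 2)) / y ^ 2 := by
        gcongr
        rw [div_le_iff₀ hy]
        have := (div_le_iff₀ hε).1 hy2
        nlinarith
    _ = ε * (3 / 2 / y ^ 2) := by ring

end Packaged

end Loewner

end Literature.Probability.RandomPlanarGeometry
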